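import Summits.QuantumFields.YangMills.Theorems.UnitScaleTiltFluctuationComparisonRegPrGlobalSlackKernelLegDisplayTwoRunProfileV4
import Summits.QuantumFields.YangMills.Theorems.UnitScaleTiltFluctuationComparisonRegPrGlobalSlackLegCfgDistNaturalRowsSel
import HarnessLib

/-!
# `UnitScaleTiltFluctuationComparisonRegPrGlobalSlackLegNaturalRowsTwoRunDoorSel` — THE NATURAL-OBJECT DOORS OF 3⁗χ(v4) IN TWO-RUN CURRENCY, SELECTED ANCHOR `B♮[sel]`: THE DISPLAY `K1aLegRowsDisplayTwoRunChiAtV4` FROM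
# PRINT'S (43) KERNEL ROW, ONE ANALYTICITY ROW AND EXACTLY THE TWO ONE-FAMILY TWO-RUN ROWS (crux `FluctuationComparisonRegPrIntL`, stmt-QuantumFields-20520, skeleton v5kD, STUB 3⁗χ(v4)
# `stub_globalTwoRunSlackFamChiV4`; LEAD ym-ust-20520-w2 g5, ★★OWNER ACK 50 (4)/51 (2) «GO-(B)» + LEAD's anchor-selector currency after ym-inputs-p12 g6's located defect; count-neutral
# helper, def-free, registry untouched; the `B♮ᴿ`-doors `…NaturalRowsTwoRunDoor` (p635014) are the instance `sel := fun K b Y ↦ (anchors_nonempty K b Y).choose`)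

WHY.  ym-inputs-p11's doors ✓`k1aLegRowsDisplayChiAtLowV4_of_naturalRows` / ✓`k1aLegRowsDisplayChiAtLowV4_of_kernelRows` (`…LegCfgDistNaturalRowsDoor` §2–§3) reach the PER-RUN display of
record, whose (R1)/(R5) are stated against reference objects `Ψ` (height-free charts) and `BR` (coherent loop variables) that a supplier holding ONE family's TWO-RUN rows would
first have to construct (ym-inputs-p10 g2's `exists_kernelRefOwnΦ_of_twoRun` / `exists_refCfgCoherent_of_twoRun`) — at all indices for (R1), with tree-length and symmetry letters
off the listed sets — only for the consumer to convert back (LOCATED 2026-08-28, this seat).  With the two-run display `K1aLegRowsDisplayTwoRunChiAtV4` (`…KernelLegDisplayTwoRunProfileV4`,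
this seat) the doors are stated in the supplier's own currency and the reference objects disappear.  ANCHOR: ym-inputs-p12 g6 LOCATED that with the per-run `Classical.choose` anchor of
`B♮ᴿ` the two-run row (BC) is not dischargeable as typed; here the configuration family is `B♮[sel]` for an ARBITRARY selector `sel K b Y ∈ anchors K b Y` (`…CfgDistNaturalRowsSel`),
so that a RUN-COHERENT selector (p12 g6's `exists_anchorSel_coherent`) can be plugged in and (BC)[B♮[sel]] is well-posed:

* §1 ★ **`k1aLegRowsDisplayTwoRunChiAtV4_of_naturalRowsSel`** (Φ free, `B := B♮[sel]`): constants `κ′ ρ C C_A C_B γB`; for every family / coupling / inhabited χ-package a coherent `p` and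
  charts `Φ`, vacuum constants `e` with (K) `FlatKernelLegCauchyΦ … Φ …`, (A) `ChartAnalyticΦ … (rescaleΦw … Φ) …`, the new-level clauses (`Φ = birthChartRows q`, `e = 0` on the retained
  domains), (M1) `OldTermsAreJetsOwnRows q Φ e B♮[sel]` and (BC) `CfgDistCauchyΦ … B♮[sel] … 𝔠.b₀ p₁ a C_B` ⟹ `K1aLegRowsDisplayTwoRunChiAtV4 L 𝔠 a₀ a₁ a p₁` for every `p₁ ≥ p₀ + r₀` —
  (N)'s configuration clause by `naturalRowsSel_newLevel_eq_bcfg`, (S) = THE I-11 ROW (44) DISCHARGED by `cfgDistΦ_chiV4_naturalSel_of_le_gammaθ` (constant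
  `max (24LB₃) (cB(√L)⁻¹(1+log √L)^{p₁})`, threshold `min γB (gammaθ b₀ p₁ σ♮)`).
* §2 ★★ **`k1aLegRowsDisplayTwoRunChiAtV4_of_kernelRowsSel`** (`L < 𝔠.M₁`): for every family / coupling / inhabited χ-package a coherent `p` and a LEG-INDEXED `𝔤ᶜ`-KERNEL FAMILY `N` with
  PRINT'S (43) KERNEL ROW on the record's `oldTermRows` (read at `B♮[sel]`), (K)[Φ♮], (A)[rescaleΦw Φ♮] and (BC)[B♮[sel]] ⟹ the display — §1 at the natural chart family `Φ♮[birthChartRows q, N]`, `e := 0`,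
  with p11's ✓`naturalChart_of_forall_ne` / ✓`hsep_of_lt` and `oldTermsAreJetsOwnRows_naturalSel_of_kernelRow`.  SO, for the natural objects, the residue of 3⁗χ(v4)'s display — hence of
  the DECIDING crux modulo T8 and 2′χ(v4) (`InteriorExcision.regPrIntL_of_T8_recChiV4_k1aLegRowsDisplayTwoRunChiAtV4_allL`) — is: (43) = the definition of `oldVal` in print's form,
  ONE analyticity row (birth-chart locality + the (43) kernel budget, ✓`chartAnalyticOwnΦ_rescaleW_naturalChart_rows`), and EXACTLY THE TWO ONE-FAMILY TWO-RUN ROWS (K) and (BC)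
  — the cross-cut-off comparison that is UNPRINTED for non-abelian `d = 3` (E2 = NO).  No reference objects, no letters at unlisted indices.

HONEST SCOPE.  Bookkeeping: the doors REDUCE the display to named hypothesis rows; (43), (K), (A), (BC) are NOT asserted; nothing of [Balaban1985UV3] / [King1986] is asserted; no
stub / crux / registry object touched (`--supports stmt-QuantumFields-20520`); no summit / rung / gap claim (YM₃ on T³ is ladder rung R3, not the Clay problem).  L-floor: none beyond
`1 < L` (every `T3Family`); §2 carries the big-block letter `L < M₁` (print's «M₁ large»), not an `L`-floor.

References: T. Bałaban, CMP 102 (1985) 255–275 [Balaban1985UV3] ((7) p.257, (27)–(28) p.263, (33)–(34) p.264, (43)–(45) pp.266–267, (59)–(61) pp.270–271); C. King, CMP 102 (1986)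
649–677 [King1986] (Thm 3.4 (3.9) p.656, Prop. 3.6 (3.56) p.662, Prop. 3.9 (3.71)–(3.74) p.665); CMP 102 (1985) 277–309 [Balaban1985Variational] (Thm 1 (8) p.279); CMP 98 (1985) 17–51
[Balaban1985Averaging] (Prop. 2 (54) p.26); CMP 109 (1987) 249–301 [Balaban1987RG1] ((0.1) p.251).
-/

set_option autoImplicit false

noncomputable section

open scoped Matrix.Norms.L2Operator Nat
open Literature.MathematicalPhysics.QuantumFieldTheory.Balaban1983to89
open Literature.MathematicalPhysics.QuantumFieldTheory.Balaban1983to89.T3ContinuumYM3Torus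
open Literature.MathematicalPhysics.QuantumFieldTheory.Balaban1983to89.T3UnitLawDensityEML (ℰp)
open Literature.MathematicalPhysics.QuantumFieldTheory.Balaban1983to89.T3UnitScaleTilt (θBal)
open Literature.MathematicalPhysics.QuantumFieldTheory.Balaban1983to89.T3LevelShift (fieldShift)
open Literature.MathematicalPhysics.QuantumFieldTheory.Balaban1983to89.T3AlphaInputsAC (AlphaDataT3)
open Literature.MathematicalPhysics.QuantumFieldTheory.Balaban1983to89.TreeLengthTorus (tsys)
open Literature.MathematicalPhysics.QuantumFieldTheory.Balaban1983to89.B10Eq27TorusAxialLog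
open Literature.MathematicalPhysics.QuantumFieldTheory.Balaban1983to89.B7Prop1Explicit (l1)
open Literature.MathematicalPhysics.QuantumFieldTheory.Balaban1983to89.ExpMeanLog (deltaSU deltaSU_pos)
open Literature.MathematicalPhysics.QuantumFieldTheory.Balaban1985CMP102
open Literature.MathematicalPhysics.QuantumFieldTheory.Balaban1985CMP102.Setting
open Summit.QuantumFields.Balaban3D.Carriers
open Summit.QuantumFields.Balaban3D.Proofs.Primitives
open Summit.QuantumFields.Balaban3D.Proofs.GroupModelLieC (vecE lieC)
open Summit.QuantumFields.YangMills.Theorems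
open Summit.QuantumFields.YangMills.Theorems.GlobalSlackKernelMatching
open Summit.QuantumFields.YangMills.Theorems.GlobalSlackCanonicalPolymers

namespace Summit.QuantumFields.YangMills.Theorems.GlobalSlackKernelLeg

variable (sel : (F : T3Family) → (K b : ℕ) → Set (Site (F.P K) 0) → Site (F.P K) b)
  (hsel : ∀ (F : T3Family) (K b : ℕ) (Y : Set (Site (F.P K) 0)), sel F K b Y ∈ anchors K b Y)

include hsel

/-! ## §1 The two-run display from its rows at `B := B♮[sel]` (Φ free) -/

open Classical in
/-- ★ **THE TWO-RUN DISPLAY FROM ITS ROWS AT `B := B♮[sel]`** (`sel K b Y ∈ anchors K b Y`): (K) `FlatKernelLegCauchyΦ`, (A) leg-weighted analyticity, the new-level chart / vacuum-constant clauses, (M1) and (BC)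
`CfgDistCauchyΦ` for the natural configuration family of the v4 χ-package's rows record, with constants `κ′ ρ C C_A C_B` and a threshold `γB`, give
`K1aLegRowsDisplayTwoRunChiAtV4 L 𝔠 a₀ a₁ a p₁` for every `p₁ ≥ p₀ + r₀` — (N)'s configuration clause by `naturalRowsSel_newLevel_eq_bcfg`, (S) (44) `CfgDistΦ … B♮[sel] …` DISCHARGED by
`cfgDistΦ_chiV4_naturalSel_of_le_gammaθ` (constant `max (24·L·B₃) (cB·(√L)⁻¹(1+log √L)^{p₁})`, threshold `min γB (gammaθ b₀ p₁ σ♮)`).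
[cite: Balaban1985UV3, (27)-(28) p.263, (43)-(45) pp.266-267, (60)-(61) p.271; Balaban1985Variational, Thm 1 (8) p.279; King1986, Prop. 3.6 (3.56) p.662, Prop. 3.9 (3.71)-(3.74) p.665] -/
theorem k1aLegRowsDisplayTwoRunChiAtV4_of_naturalRowsSel {L : ℕ} (hL : 1 < L) {𝔠 : AlphaConsts L (suGroupModel 2).N} {a₀ a₁ a p₁ : ℝ} (ha₀ : 0 < a₀) (ha₁ : 0 < a₁)
    (hp₁ : 𝔠.p₀ + 𝔠.r₀ ≤ p₁)
    (h : ∃ (κ' ρ C C_A C_B γB : ℝ), 0 < κ' ∧ 0 < ρ ∧ 0 ≤ C ∧ 0 ≤ C_A ∧ 0 ≤ C_B ∧ 0 < γB ∧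
      ∀ (F : T3Family) (γ : ℝ) (hF : F.L = L) (hγ : 0 < γ), γ ≤ γB → ∀ (hγ1 : γ ≤ (min (hF ▸ 𝔠).gamma0 1) ^ 2),
        AlphaInputsT3AC.OfV4ChiAt F (hF ▸ 𝔠) a₀ a₁ →
          ∃ (p : ∀ K, AlphaInputsT3AC.PkgAtV4Chi F (hF ▸ 𝔠) γ hγ hγ1 K), (∀ K, (p K).a₀ = a₀ ∧ (p K).a₁ = a₁) ∧
            ∃ (Φ : ChartFam ↥(lieC (suGroupModel 2)) F) (e : VacFam F),
              FlatKernelLegCauchyΦ (AlphaInputsT3AC.dataOfV4chi p (canonPolymerRows fun K => (p K).toRows)) Φ (canonLegDist F) κ' (hF ▸ 𝔠).κ a C ∧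
              ChartAnalyticΦ (AlphaInputsT3AC.dataOfV4chi p (canonPolymerRows fun K => (p K).toRows)) (rescaleΦw (canonLegDist F) κ' Φ) (hF ▸ 𝔠).κ ρ C_A ∧
              (∀ (K k : ℕ), k + 1 ≤ K → ∀ X ∈ newDomsRows (fun K => (p K).toRows) K k (Hist.triv (F.P K) (k + 1)),
                Φ K k (domSet (F := F) (hF ▸ 𝔠).lane.carrier.M₁ K k X) = birthChartRows (fun K => (p K).toRows) K k (domSet (F := F) (hF ▸ 𝔠).lane.carrier.M₁ K k X) ∧
                e K k (domSet (F := F) (hF ▸ 𝔠).lane.carrier.M₁ K k X) = 0) ∧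
              OldTermsAreJetsOwnRows (fun K => (p K).toRows) Φ e
                (fun K k b Y W c =>
                  if h : b + 1 = k then birthCfgAtRows (fun K => (p K).toRows) K b Y (h ▸ W) c
                  else if (l1 (rel (sel F K b Y) c.src) : ℝ) *
                      (2 * ((hF ▸ 𝔠).B₃ * θBal F.L γ (hF ▸ 𝔠).b₀ p₁ (K - k)) * (((F.L : ℝ) ^ (k - b))⁻¹) ^ 2) ≤ 1 / 2 then
                    (lieC (suGroupModel 2)).orthogonalProjectionOnto
                      (vecE (suGroupModel 2).N
                        (B27T (unitsField (toUField (Averaging.iter (fun i => BlockAveraging.blockAvg (P := F.P K) (j := i) ℰp) b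
                          ((p K).UkH k (Hist.triv (F.P K) k) W)))) (sel F K b Y) c))
                  else 0) ∧
              CfgDistCauchyΦ (AlphaInputsT3AC.dataOfV4chi p (canonPolymerRows fun K => (p K).toRows))
                (fun K k b Y W c =>
                  if h : b + 1 = k then birthCfgAtRows (fun K => (p K).toRows) K b Y (h ▸ W) c
                  else if (l1 (rel (sel F K b Y) c.src) : ℝ) *
                      (2 * ((hF ▸ 𝔠).B₃ * θBal F.L γ (hF ▸ 𝔠).b₀ p₁ (K - k)) * (((F.L : ℝ) ^ (k - b))⁻¹) ^ 2) ≤ 1 / 2 then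
                    (lieC (suGroupModel 2)).orthogonalProjectionOnto
                      (vecE (suGroupModel 2).N
                        (B27T (unitsField (toUField (Averaging.iter (fun i => BlockAveraging.blockAvg (P := F.P K) (j := i) ℰp) b
                          ((p K).UkH k (Hist.triv (F.P K) k) W)))) (sel F K b Y) c))
                  else 0)
                (canonLegDist F) (hF ▸ 𝔠).b₀ p₁ a C_B) :
    K1aLegRowsDisplayTwoRunChiAtV4 L 𝔠 a₀ a₁ a p₁ := by
  obtain ⟨κ', ρ, C, C_A, C_B, γB, hκ', hρ, hC, hCA, hCB, hγB, hall⟩ := h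
  have hB : 0 < 𝔠.B₃ := 𝔠.B₃_pos
  have hδ : 0 < deltaSU (Fin 2) := deltaSU_pos
  have hp₁' : 0 < p₁ := by have := 𝔠.p₀_pos; have := 𝔠.one_le_r₀; linarith
  have hL7 : (0 : ℝ) < (((3 + 4) * L : ℕ) : ℝ) := by
    have h7 : 0 < (3 + 4) * L := by omega
    exact_mod_cast h7
  set σ : ℝ := min a₁ (min (a₀ / 𝔠.B₃) (min (1 / (3 * (143 * ((((3 + 4 : ℕ) : ℝ)) ^ 2 / 4) ^ 2) * 𝔠.B₃))
      (deltaSU (Fin 2) / ((((3 + 4) * L : ℕ) : ℝ) ^ 2 * 𝔠.B₃)))) with hσ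
  have hσpos : 0 < σ := by rw [hσ]; positivity
  have hCs : (0 : ℝ) ≤ max (24 * (L : ℝ) * 𝔠.B₃) (𝔠.cB * ((Real.sqrt L)⁻¹ * (1 + Real.log (Real.sqrt L)) ^ p₁)) :=
    le_max_of_le_left (by positivity)
  refine ⟨κ', ρ, C, C_A, max (24 * (L : ℝ) * 𝔠.B₃) (𝔠.cB * ((Real.sqrt L)⁻¹ * (1 + Real.log (Real.sqrt L)) ^ p₁)), C_B, min γB (gammaθ 𝔠.b₀ p₁ σ),
    hκ', hρ, hC, hCA, hCs, hCB, lt_min hγB (gammaθ_pos 𝔠.b₀_pos hp₁' hσpos), fun F γ hF hγ hγle hγ1 hOf => ?_⟩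
  subst hF
  obtain ⟨p, hp, Φ, e, hK, hA, hNΦe, hM1, hBC⟩ := hall F γ rfl hγ (hγle.trans (min_le_left _ _)) hγ1 hOf
  refine ⟨p, hp, Φ, e,
    (fun K k b Y W c =>
        if h : b + 1 = k then birthCfgAtRows (fun K => (p K).toRows) K b Y (h ▸ W) c
        else if (l1 (rel (sel F K b Y) c.src) : ℝ) *
            (2 * (𝔠.B₃ * θBal F.L γ 𝔠.b₀ p₁ (K - k)) * (((F.L : ℝ) ^ (k - b))⁻¹) ^ 2) ≤ 1 / 2 then
          (lieC (suGroupModel 2)).orthogonalProjectionOnto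
            (vecE (suGroupModel 2).N
              (B27T (unitsField (toUField (Averaging.iter (fun i => BlockAveraging.blockAvg (P := F.P K) (j := i) ℰp) b
                ((p K).UkH k (Hist.triv (F.P K) k) W)))) (sel F K b Y) c))
        else 0), hK, hA, ?_, hM1, cfgDistΦ_chiV4_naturalSel_of_le_gammaθ (sel F) (hsel F) p ha₀ ha₁ hp hp₁ (hγle.trans (min_le_right _ _)), hBC⟩
  intro K k hk X hX
  obtain ⟨hΦ, he⟩ := hNΦe K k hk X hX
  exact ⟨hΦ, he, fun W => naturalRowsSel_newLevel_eq_bcfg (sel F) (fun K => (p K).toRows) K k hk X hX W⟩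

/-! ## §2 The two-run display from print's (43) kernel row at the natural objects -/

open Classical in
/-- ★★ **THE TWO-RUN DISPLAY FROM PRINT'S (43) KERNEL ROW, ONE ANALYTICITY ROW AND THE TWO ONE-FAMILY TWO-RUN ROWS AT THE NATURAL OBJECTS** `(Φ♮[birthChartRows q, N], 0, B♮[sel])`
(`q = toRows ∘ p`): if, with constants `κ′ ρ C C_A C_B γB`, every family (`F.L = L`), coupling `γ ≤ γB` and inhabited χ-package admit a coherent `p` and a LEG-INDEXED KERNEL FAMILY `N`
with — PRINT'S (43) KERNEL ROW «`oldTermRows q K k (1+j) y W = Re Σ_n (n!)⁻¹ Σ_c N K j y n c (B♮ᴿ ∘ c)`», (K) `FlatKernelLegCauchyΦ … Φ♮ (canonLegDist F) κ′ 𝔠.κ a C` (the charts'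
weighted flat kernels of runs `K`, `K+1` are close), (A) `ChartAnalyticΦ … (rescaleΦw (canonLegDist F) κ′ Φ♮) 𝔠.κ ρ C_A` and (BC) `CfgDistCauchyΦ … B♮[sel] (canonLegDist F) 𝔠.b₀ p₁ a C_B`
(the loop variables of runs `K`, `K+1` are close — well-posed for a run-coherent `sel`) — then, for big blocks bigger than one averaging block (`L < M₁`), `K1aLegRowsDisplayTwoRunChiAtV4 L 𝔠 a₀ a₁ a p₁` for every
`p₁ ≥ p₀ + r₀` (§1 at `Φ := Φ♮`, `e := 0`, with ✓`hsep_of_lt`, ✓`naturalChart_of_forall_ne`, `oldTermsAreJetsOwnRows_naturalSel_of_kernelRow`).  What remains displayed is print-shaped: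
(43) is the definition of `oldVal`, (A) is birth-chart locality + the (43) kernel budget, and (K)/(BC) are THE TWO cross-cut-off rows, UNPRINTED for non-abelian `d = 3` (E2 = NO).
[cite: Balaban1985UV3, (27)-(28) p.263, (33)-(34) p.264, (43)-(45) pp.266-267, (59)-(61) pp.270-271; King1986, Prop. 3.6 (3.56) p.662, Prop. 3.9 (3.71)-(3.74) p.665] -/
theorem k1aLegRowsDisplayTwoRunChiAtV4_of_kernelRowsSel {L : ℕ} (hL : 1 < L) {𝔠 : AlphaConsts L (suGroupModel 2).N} (hM : L < 𝔠.M₁) {a₀ a₁ a p₁ : ℝ}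
    (ha₀ : 0 < a₀) (ha₁ : 0 < a₁) (hp₁ : 𝔠.p₀ + 𝔠.r₀ ≤ p₁)
    (h : ∃ (κ' ρ C C_A C_B γB : ℝ), 0 < κ' ∧ 0 < ρ ∧ 0 ≤ C ∧ 0 ≤ C_A ∧ 0 ≤ C_B ∧ 0 < γB ∧
      ∀ (F : T3Family) (γ : ℝ) (hF : F.L = L) (hγ : 0 < γ), γ ≤ γB → ∀ (hγ1 : γ ≤ (min (hF ▸ 𝔠).gamma0 1) ^ 2),
        AlphaInputsT3AC.OfV4ChiAt F (hF ▸ 𝔠) a₀ a₁ →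
          ∃ (p : ∀ K, AlphaInputsT3AC.PkgAtV4Chi F (hF ▸ 𝔠) γ hγ hγ1 K), (∀ K, (p K).a₀ = a₀ ∧ (p K).a₁ = a₁) ∧
            ∃ (N : (K b : ℕ) → Site (F.P K) (1 + b) → (n : ℕ) → (Fin n → PBond (F.P K) b) →
                ContinuousMultilinearMap ℂ (fun _ : Fin n => ↥(lieC (suGroupModel 2))) ℂ),
              (∀ (K k : ℕ), k + 1 ≤ K → ∀ j : ℕ, j < k →
                ∀ y ∈ oldBlocks (hF ▸ 𝔠).lane.carrier.M₁ (rcolOf (SK F (hF ▸ 𝔠) γ hγ hγ1 K) (hF ▸ 𝔠).lane.carrier) (Hist.triv (F.P K) (k + 1)) (1 + j),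
                  ∀ W : GaugeField (F.P K) (k + 1) (Matrix.specialUnitaryGroup (Fin 2) ℂ),
                    oldTermRows (fun K => (p K).toRows) K k (1 + j) y W =
                      (∑ n ∈ Finset.Ico 2 7, ((n ! : ℂ))⁻¹ * ∑ c : Fin n → PBond (F.P K) j, N K j y n c (fun i =>
                        (fun K k b Y W c =>
                          if h : b + 1 = k then birthCfgAtRows (fun K => (p K).toRows) K b Y (h ▸ W) c
                          else if (l1 (rel (sel F K b Y) c.src) : ℝ) *
                              (2 * ((hF ▸ 𝔠).B₃ * θBal F.L γ (hF ▸ 𝔠).b₀ p₁ (K - k)) * (((F.L : ℝ) ^ (k - b))⁻¹) ^ 2) ≤ 1 / 2 then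
                            (lieC (suGroupModel 2)).orthogonalProjectionOnto
                              (vecE (suGroupModel 2).N
                                (B27T (unitsField (toUField (Averaging.iter (fun i => BlockAveraging.blockAvg (P := F.P K) (j := i) ℰp) b
                                  ((p K).UkH k (Hist.triv (F.P K) k) W)))) (sel F K b Y) c))
                          else 0) K (k + 1) j (blockSet K (1 + j) y) W (c i))).re) ∧
              FlatKernelLegCauchyΦ (AlphaInputsT3AC.dataOfV4chi p (canonPolymerRows fun K => (p K).toRows))
                (fun K b Y =>
                  if h : ∃ y : Site (F.P K) (1 + b), blockSet K (1 + b) y = Y then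
                    (fun x : PBond (F.P K) b → ↥(lieC (suGroupModel 2)) =>
                      ∑ n ∈ Finset.Ico 2 7, ((n ! : ℂ))⁻¹ * ∑ c : Fin n → PBond (F.P K) b, N K b h.choose n c (fun i => x (c i)))
                  else birthChartRows (fun K => (p K).toRows) K b Y)
                (canonLegDist F) κ' (hF ▸ 𝔠).κ a C ∧
              ChartAnalyticΦ (AlphaInputsT3AC.dataOfV4chi p (canonPolymerRows fun K => (p K).toRows))
                (rescaleΦw (canonLegDist F) κ' fun K b Y =>
                  if h : ∃ y : Site (F.P K) (1 + b), blockSet K (1 + b) y = Y then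
                    (fun x : PBond (F.P K) b → ↥(lieC (suGroupModel 2)) =>
                      ∑ n ∈ Finset.Ico 2 7, ((n ! : ℂ))⁻¹ * ∑ c : Fin n → PBond (F.P K) b, N K b h.choose n c (fun i => x (c i)))
                  else birthChartRows (fun K => (p K).toRows) K b Y) (hF ▸ 𝔠).κ ρ C_A ∧
              CfgDistCauchyΦ (AlphaInputsT3AC.dataOfV4chi p (canonPolymerRows fun K => (p K).toRows))
                (fun K k b Y W c =>
                  if h : b + 1 = k then birthCfgAtRows (fun K => (p K).toRows) K b Y (h ▸ W) c
                  else if (l1 (rel (sel F K b Y) c.src) : ℝ) *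
                      (2 * ((hF ▸ 𝔠).B₃ * θBal F.L γ (hF ▸ 𝔠).b₀ p₁ (K - k)) * (((F.L : ℝ) ^ (k - b))⁻¹) ^ 2) ≤ 1 / 2 then
                    (lieC (suGroupModel 2)).orthogonalProjectionOnto
                      (vecE (suGroupModel 2).N
                        (B27T (unitsField (toUField (Averaging.iter (fun i => BlockAveraging.blockAvg (P := F.P K) (j := i) ℰp) b
                          ((p K).UkH k (Hist.triv (F.P K) k) W)))) (sel F K b Y) c))
                  else 0)
                (canonLegDist F) (hF ▸ 𝔠).b₀ p₁ a C_B) :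
    K1aLegRowsDisplayTwoRunChiAtV4 L 𝔠 a₀ a₁ a p₁ := by
  obtain ⟨κ', ρ, C, C_A, C_B, γB, hκ', hρ, hC, hCA, hCB, hγB, hall⟩ := h
  refine k1aLegRowsDisplayTwoRunChiAtV4_of_naturalRowsSel sel hsel hL ha₀ ha₁ hp₁ ⟨κ', ρ, C, C_A, C_B, γB, hκ', hρ, hC, hCA, hCB, hγB, fun F γ hF hγ hγle hγ1 hOf => ?_⟩
  obtain ⟨p, hp, N, hK43, hK, hA, hBC⟩ := hall F γ hF hγ hγle hγ1 hOf
  subst hF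
  exact ⟨p, hp, _, fun _ _ _ => 0, hK, hA,
    fun K k hk X hX => ⟨naturalChart_of_forall_ne _ N (hsep_of_lt (fun K => (p K).toRows) hM K k hk X hX), rfl⟩,
    oldTermsAreJetsOwnRows_naturalSel_of_kernelRow (sel F) (fun K => (p K).toRows) N hK43, hBC⟩

end Summit.QuantumFields.YangMills.Theorems.GlobalSlackKernelLeg

end
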